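import Mathlib
import Summits.NavierStokesRegularity.NavierStokesRegularity.Theorems.TaoLadderRungTwoFlatConditionalBlock
import Summits.NavierStokesRegularity.NavierStokesRegularity.Theorems.TaoLadderRungTwoFlatTubeBlockLoop
import HarnessLib

/-!
# THE TUBE-HOP ANALOGUE OF THE INTERFACE BOOTSTRAP (per premise): the interface loop of record on a sub-horizon, and the joint
  closure of a CONDITIONAL core-block enclosure against the co-scaled reference family `W z`
  (helper for the K_A♭ parent item stmt-NavierStokesRegularity-22987 `FlatGapCertificatesV2`, child 2A, route TaoLadderRungTwoFlat;
  cell harvest/h2-tao-ladder, p1 g25; theory-1 W-34 «tube-phase Λ» / A70-3 at hops `n > N₀`)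

At a tube hop the three flow-dependent inputs of `tubeStep_of_schedule_split` (…TubeStepSplit) that an enclosure produces are the
deeper core input `hcore2` (`|(S − W z)₀(2−K, ·)| ≤ ρ₂` on `[0, t]`), the ahead window readout `hwinA` and the window-top hull `hVt`;
the core landing contract `CoreLandingFromZ` is ALREADY conditional on the interface levels at `1−K`. An enclosure of the core block
`[2−K, k_B]` of the infinite lattice is honest only CONDITIONALLY on boxes at its two interfaces: the near shell `1−K` (deviation from
`W z` below the fat levels `2·RBAR`, `2·BBAR`) and the shell `k_B + 1` (`|S| ≤ 4G`). This module closes the condition per premise: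
* `tubeBlock_closure` — the JOINT BOOTSTRAP per kick-ball flow on `[0, s₀]` (`s₀ ≤ τ`, `s₀ ≤ c₀`; closings at `c₀`, so the SHORT flows of the
  K4 argument are covered): conditional core-block row + `interfaceLevels_flow_at` (…TubeBlockLoop) below + `aheadCutStep_flow` above
  (uniform family bootstrap over the four interface quantities, Lipschitz moduli from the two flows' qualitative a-priori bounds)
  ⇒ on all of `[0, s₀]`: the block deviation `|(S − W z)_{ik}| ≤ D_k` (`2−K ≤ k ≤ k_B`), the interface levels `(RBAR, BBAR)` at
  `1−K`, and the cut envelope `|S_{im}| ≤ 2G` beyond `k_B`.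

HONEST FRAMING: bookkeeping and one continuity argument over the cell's typed frame (MODEL lattice); the conditional block row is a
BOOKED HYPOTHESIS; nothing certified; no item closed; nothing about the Navier–Stokes equations.
-/

noncomputable section

-- the sub-problem namespace repeats the summit name by design (D-0017)
set_option linter.dupNamespace false

namespace Summit.NavierStokesRegularity.NavierStokesRegularity.Theorems.HopTube

open Set Finset Filter Topology Literature.Analysis.FluidPDE Literature.Analysis.FluidPDE.TaoCascade MirrorPulse RenormFrame QuadPolar
  GappedFrontRobustOn

section Flow

variable {ε ε₀ : ℝ}

set_option maxHeartbeats 1600000 in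
/-- **THE JOINT INTERFACE BOOTSTRAP AT A TUBE HOP (per flow).** For one kick-ball flow of `H(n)` (`n > N₀`) on `[0, τ]`, a bootstrap horizon
`s₀ ≤ τ`, `s₀ ≤ c₀` (closings at `c₀`) and the co-scaled reference `W z`: the CONDITIONAL core-block row («`|(S − W z)₀(1−K)| ≤ 2RBAR`, `|(S − W z)₁(1−K)| ≤ 2BBAR`, `|Sᵢ(k_B+1)| ≤ 4G` on `[0, t]`
⇒ `|(S − W z)_{ik}| ≤ D_k` on `2−K ≤ k ≤ k_B` on `[0, t]`», every `t ≤ s₀`), `D_{2−K} ≤ ρ₂`, the schedule of `interfaceLevels_flow`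
(closing the near side) and the first cut's data above `k_B` (hull row `|W z₁(k_B)| + D_{k_B} ≤ V_top`, initial tail `G`, closing
inequality) give on ALL of `[0, s₀]`: the block deviation, the interface levels `(RBAR, BBAR)` and the cut envelope `2G` beyond `k_B`.
[cite: Tao2016AveragedNS, §4 (4.1), (4.3), (4.5), (4.8), §5 (continuity argument), §6.3–6.4 (statement shape); cell LADDER §59–§62, §70 (A70-3, W-34)] -/
theorem tubeBlock_closure (P : TubeSchedule) {θ' : ℝ} {Wb : ℕ → ℝ} {i₀ : Fin 2}
    {Bcl : ℕ → (Fin 2 → ℤ → ℝ) → Prop} (hBcl : ∀ m z, Bcl m z → behindR54 P θ' Wb m z)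
    {X₀ : Fin 2 → ℝ} {w : ℤ → ℝ} {r c₀ : ℝ} {ζ : ℕ → Fin 2 → ℤ → ℝ} {ustar : Fin 2 → ℤ → ℝ} {n : ℕ}
    {cW κ₂ : ℝ} {W₀ FW₀ BW₀ : (Fin 2 → ℤ → ℝ) → Fin 2 → ℤ → ℝ} {W FW : (Fin 2 → ℤ → ℝ) → Fin 2 → ℤ → ℝ → ℝ}
    (hWflow : ∀ z, InTubeWith P Bcl i₀ X₀ w r ζ ustar n z →
      PseudoFlowOnShift shiftSetFlat cW ε₀ (mirrorTable ε ε) 0 κ₂ (W₀ z) (FW₀ z) (BW₀ z) (W z) (FW z)) (hcW : c₀ ≤ cW)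
    (hε : 0 ≤ ε) (hε₀ : 0 < ε₀) (hn : P.N₀ < n) (hK : 1 ≤ P.K) (hDK : P.K + 1 ≤ P.D) (hθV : 0 < P.θV)
    (hθ : 0 < θ') (hθ5 : θ' ≤ 5 * Real.log (1 + ε₀)) (hw1 : ∀ k, 1 ≤ w k) (hr0 : 0 ≤ r) (hc₀ : 0 < c₀)
    (hAstar : 0 < P.Astar) {ωK MuK : ℝ} (hωK : 0 < ωK)
    (hωKle : ∀ i, ωK ≤ MirrorPulse.geomGauge P.g P.b i (-(P.K : ℤ))) (hMuK : ∀ i, |ustar i (-(P.K : ℤ))| ≤ MuK)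
    (hWbn : 0 ≤ Wb n)
    {Aeff A A₀ A₁ M M₁ M₂ rI RBAR BBAR RHO2 rs I₁ I₂ PUMP μN μB VbarN VbarB EW V₀N V₀B EN : ℝ}
    (hAeff : 0 < Aeff) (hM0 : 0 ≤ M)
    (hM : ∀ z, InTubeWith P Bcl i₀ X₀ w r ζ ustar n z →
      ∀ s ∈ Icc 0 c₀, ∀ i, ∀ m ∈ Finset.Icc (-(P.D : ℤ)) (1 - (P.K : ℤ)), |W z i m s| ≤ M)
    (hM₁ : ∀ z, InTubeWith P Bcl i₀ X₀ w r ζ ustar n z → ∀ s ∈ Icc 0 c₀, |W z 1 (-(P.K : ℤ)) s| ≤ M₁)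
    (hM₂0 : 0 ≤ M₂)
    (hM₂ : ∀ z, InTubeWith P Bcl i₀ X₀ w r ζ ustar n z → ∀ s ∈ Icc 0 c₀, |W z 0 (2 - (P.K : ℤ)) s| ≤ M₂)
    (hEW : ∀ z, InTubeWith P Bcl i₀ X₀ w r ζ ustar n z →
      coMovingEnergyOn (Finset.Icc (1 - (P.D : ℤ)) (-(P.K : ℤ))) P.θV (-(P.K : ℝ))
        (fun i k _ => anchorScale P i₀ z * ustar i k - W₀ z i k) 0 ≤ EW)
    (hρ0 : 0 ≤ RHO2)
    (hRB0 : 0 < RBAR) (hBB0 : 0 < BBAR) (hRr : RBAR ≤ rI) (hBr : BBAR ≤ rI) (hVN0 : 0 ≤ VbarN)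
    (hI₁0 : 0 ≤ I₁) (hI₂0 : 0 ≤ I₂)
    (hI₁ : 2 * (Real.exp (P.θV / 2) - 1) ≤ I₁ * P.θV) (hI₂ : Real.exp P.θV - 1 ≤ I₂ * P.θV)
    (hPUMPdef : PUMP = 1 * c₀ * ((2 + ε) * M * I₁ * Real.sqrt (2 * VbarN) + 2 * I₂ * VbarN))
    (hlevC : rs + PUMP + 1 * c₀ * ((ε * (M + I₁ * Real.sqrt (2 * VbarN)) + ε * M + ε * BBAR) * RBAR
      + (2 + ε) * M * BBAR + BBAR ^ 2) < RBAR)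
    (hlevV : rs + 1 * c₀ * ((M + M₂ + RBAR + RHO2) * BBAR + (1 + 2 * ε) * M * RBAR + ε * RBAR ^ 2
      + (M + 2 * ε * M₂) * RHO2 + ε * RHO2 ^ 2) < BBAR)
    (hAdef : A = Real.sqrt (2 * VbarB) * Real.exp (θ' / 2) * Real.exp (θ' * ((P.D : ℝ) - P.K) / 2) + M)
    (hA₀def : A₀ = M + rI) (hA₁def : A₁ = M₁ + Real.sqrt (2 * VbarN) * Real.exp (P.θV / 2))
    (hrA : rI ≤ A) (hA₀le : A₀ ≤ Aeff)
    (hV₀Ndef : V₀N = (Real.sqrt (P.v n + (P.δ n / ωK) ^ 2) + Real.sqrt P.D * r + Real.sqrt EW) ^ 2)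
    (hV₀Bdef : V₀B = (Real.sqrt (Wb n + (MuK + P.δ n / ωK) ^ 2) + r / Real.sqrt (1 - Real.exp (-θ'))) ^ 2)
    (hENdef : EN = Real.exp (P.θV * ((1 : ℝ) - P.D + P.K)) * ((1 + ε) * 1 * A ^ 2 * (A + M))
      + 1 * rI * (2 * VbarN + ε * rI * Real.sqrt (2 * VbarN) + (1 + ε) * M * rI))
    (hμN : 0 < μN)
    (hμNle : μN ≤ (1 / c₀) * P.θV - 2 * (1 + ε) * 1 * (A * Real.sinh (P.θV / 2) + M * (3 + Real.exp P.θV)))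
    (hμB : 0 < μB) (hμBle : μB ≤ (1 / c₀) * θ' - 2 * (1 + ε) * Aeff * Real.sinh (θ' / 2))
    (hlevN : V₀N + EN * c₀ < VbarN) (hlevB : V₀B + A₁ * A₀ * (A₁ + ε * A₀) * c₀ < VbarB)
    (hclose : Real.sqrt (2 * VbarB) * Real.exp (θ' / 2) ≤ Aeff)
    -- ONE kick-ball flow of `H(n)` on `[0, τ]`, the bootstrap horizon `s₀ ≤ τ`, `s₀ ≤ c₀`, and its section datum
    {z S₀ : Fin 2 → ℤ → ℝ} {τ : ℝ} {S F : Fin 2 → ℤ → ℝ → ℝ} (hz : InTubeWith P Bcl i₀ X₀ w r ζ ustar n z)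
    (hkick : ∀ i k, w k * |S₀ i k - z i k| ≤ r)
    (hflow : PseudoFlowOnShift shiftSetFlat τ ε₀ (mirrorTable ε ε) 0 0 S₀ (fun i k => (1 / 2) * S₀ i k ^ 2) (fun _ _ => 0) S F)
    {s₀ : ℝ} (hs₀ : 0 < s₀) (hs₀τ : s₀ ≤ τ) (hs₀c : s₀ ≤ c₀)
    (hsec : ∀ i, |(S - W z) i (1 - (P.K : ℤ)) 0| ≤ rs)
    -- THE CORE BLOCK `[2−K, k_B]`: conditional enclosure row for this flow up to `s₀`, profile, data above the block
    {kB : ℤ} (hKB : 2 - (P.K : ℤ) ≤ kB) {Dk : ℤ → ℝ} {G Vtop : ℝ} (hG : 0 < G) (hVtop : 0 ≤ Vtop)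
    (hblock : ∀ t ∈ Icc 0 s₀,
      (∀ s ∈ Icc 0 t, |(S - W z) 0 (1 - (P.K : ℤ)) s| ≤ 2 * RBAR ∧ |(S - W z) 1 (1 - (P.K : ℤ)) s| ≤ 2 * BBAR ∧
          ∀ i : Fin 2, |S i (kB + 1) s| ≤ 4 * G) →
        ∀ s ∈ Icc 0 t, ∀ (i : Fin 2) (k : ℤ), 2 - (P.K : ℤ) ≤ k → k ≤ kB → |(S - W z) i k s| ≤ Dk k)
    (hρD : Dk (2 - (P.K : ℤ)) ≤ RHO2)
    (hVt : ∀ s ∈ Icc 0 c₀, |W z 1 kB s| + Dk kB ≤ Vtop)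
    (hinit : ∀ N : Finset ℤ, (∀ m ∈ N, kB < m) → ∑ m ∈ N, ∑ i : Fin 2, S₀ i m ^ 2 ≤ G ^ 2)
    (hcloseA : 4 / 3 * c₀ * clock ε₀ kB * Vtop * (Vtop + 2 * ε * G) < G) :
    ∀ s ∈ Icc 0 s₀, (∀ (i : Fin 2) (k : ℤ), 2 - (P.K : ℤ) ≤ k → k ≤ kB → |(S - W z) i k s| ≤ Dk k) ∧
      (|(S - W z) 0 (1 - (P.K : ℤ)) s| ≤ RBAR ∧ |(S - W z) 1 (1 - (P.K : ℤ)) s| ≤ BBAR) ∧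
      (∀ (i : Fin 2) (m : ℤ), kB < m → |S i m s| ≤ 2 * G) := by
  -- the interface loop for this flow on any sub-horizon `t' ≤ s₀`, given its core input there
  have hloop : ∀ t' : ℝ, 0 < t' → t' ≤ s₀ → (∀ s ∈ Icc 0 t', |(S - W z) 0 (2 - (P.K : ℤ)) s| ≤ RHO2) →
      ∀ s ∈ Icc 0 t', |(S - W z) 0 (1 - (P.K : ℤ)) s| ≤ RBAR ∧ |(S - W z) 1 (1 - (P.K : ℤ)) s| ≤ BBAR :=
    fun t' ht' ht's hρ => interfaceLevels_flow_at P hBcl hWflow hcW hε hε₀ hn hK hDK hθV hθ hθ5 hw1 hr0 hAstar hωK hωKle hMuK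
      hWbn hAeff hM0 hM hM₁ hM₂0 hM₂ hEW hρ0 hRB0.le hBB0.le hRr hBr hVN0 hI₁0 hI₂0 hI₁ hI₂ hPUMPdef hlevC hlevV hAdef hA₀def
      hA₁def hrA hA₀le hV₀Ndef hV₀Bdef hENdef hμN hμNle hμB hμBle hlevN hlevB hclose hz hkick hflow ht' (ht's.trans hs₀τ)
      (ht's.trans hs₀c) hsec hρ
  have hWz := hWflow z hz
  -- both flows restricted to `[0, s₀]`
  have hS' := pseudoFlowOnShift_mono hflow hs₀ hs₀τ
  have hW' := pseudoFlowOnShift_mono hWz hs₀ (hs₀c.trans hcW)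
  have hT0 : 0 ≤ tableAbsSum shiftSetFlat (mirrorTable ε ε) := tableAbsSum_nonneg _ _
  set Tα := tableAbsSum shiftSetFlat (mirrorTable ε ε) with hTα
  -- a-priori bounds of the two flows (qualitative) and the Lipschitz moduli
  obtain ⟨MS, hMS⟩ := hS'.apriori_S
  obtain ⟨MW, hMW⟩ := hW'.apriori_S
  have habs : ∀ {X : Fin 2 → ℤ → ℝ → ℝ} {Mx : ℝ},
      (∀ s ∈ Icc 0 s₀, ∀ (i : Fin 2) (k : ℤ), (1 + (1 + ε₀) ^ ((10 : ℝ) * k)) * |X i k s| ≤ Mx) →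
        ∀ s ∈ Icc 0 s₀, ∀ (i : Fin 2) (k : ℤ), |X i k s| ≤ |Mx| := by
    intro X Mx h s hs i k
    have h' := h s hs i k
    have hx : 0 ≤ (1 + ε₀) ^ ((10 : ℝ) * k) := by positivity
    have h1 : |X i k s| ≤ (1 + (1 + ε₀) ^ ((10 : ℝ) * k)) * |X i k s| := by
      have h2 : 0 ≤ (1 + ε₀) ^ ((10 : ℝ) * k) * |X i k s| := mul_nonneg hx (abs_nonneg _)
      have e : (1 + (1 + ε₀) ^ ((10 : ℝ) * k)) * |X i k s| = |X i k s| + (1 + ε₀) ^ ((10 : ℝ) * k) * |X i k s| := by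
        ring
      rw [e]; linarith only [h2]
    exact h1.trans (h'.trans (le_abs_self Mx))
  have hMSa := habs hMS
  have hMWa := habs hMW
  have hderS : ∀ (i : Fin 2) (k : ℤ), ∀ s ∈ Icc 0 s₀,
      HasDerivWithinAt (S i k) (quadTermOn shiftSetFlat ε₀ (mirrorTable ε ε) S i k s) (Icc 0 s₀) s :=
    fun i k s hs => QuadPolar.hasDerivWithinAt_Icc_of_pseudoFlowOnShift_exact hS' i k hs
  have hderW : ∀ (i : Fin 2) (k : ℤ), ∀ s ∈ Icc 0 s₀,
      HasDerivWithinAt (W z i k) (quadTermOn shiftSetFlat ε₀ (mirrorTable ε ε) (W z) i k s) (Icc 0 s₀) s :=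
    fun i k s hs => QuadPolar.hasDerivWithinAt_Icc_of_pseudoFlowOnShift_exact hW' i k hs
  have hqS : ∀ (i : Fin 2) (k : ℤ), ∀ s ∈ Icc 0 s₀,
      |quadTermOn shiftSetFlat ε₀ (mirrorTable ε ε) S i k s| ≤ clockW ε₀ k * Tα * |MS| ^ 2 :=
    fun i k s hs => abs_quadTermOn_le_local isNearestNeighbourSet_shiftSetFlat hε₀.le (mirrorTable ε ε) (abs_nonneg MS)
      (fun j k' _ _ => hMSa s hs j k') i
  have hqW : ∀ (i : Fin 2) (k : ℤ), ∀ s ∈ Icc 0 s₀,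
      |quadTermOn shiftSetFlat ε₀ (mirrorTable ε ε) (W z) i k s| ≤ clockW ε₀ k * Tα * |MW| ^ 2 :=
    fun i k s hs => abs_quadTermOn_le_local isNearestNeighbourSet_shiftSetFlat hε₀.le (mirrorTable ε ε) (abs_nonneg MW)
      (fun j k' _ _ => hMWa s hs j k') i
  have hlipS : ∀ (i : Fin 2) (k : ℤ), ∀ s ∈ Icc 0 s₀, ∀ t ∈ Icc 0 s₀,
      |S i k t - S i k s| ≤ clockW ε₀ k * Tα * |MS| ^ 2 * |t - s| := by
    intro i k s hs t ht
    have h := (convex_Icc 0 s₀).norm_image_sub_le_of_norm_hasDerivWithin_le (hderS i k)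
      (fun x hx => by rw [Real.norm_eq_abs]; exact hqS i k x hx) hs ht
    rwa [Real.norm_eq_abs, Real.norm_eq_abs] at h
  have hlipD : ∀ (i : Fin 2) (k : ℤ), ∀ s ∈ Icc 0 s₀, ∀ t ∈ Icc 0 s₀,
      |(S - W z) i k t - (S - W z) i k s| ≤ clockW ε₀ k * Tα * (|MS| ^ 2 + |MW| ^ 2) * |t - s| := by
    intro i k s hs t ht
    have h := (convex_Icc 0 s₀).norm_image_sub_le_of_norm_hasDerivWithin_le
      (fun x hx => (hderS i k x hx).sub (hderW i k x hx))
      (fun x hx => by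
        rw [Real.norm_eq_abs]
        calc |quadTermOn shiftSetFlat ε₀ (mirrorTable ε ε) S i k x - quadTermOn shiftSetFlat ε₀ (mirrorTable ε ε) (W z) i k x|
            ≤ |quadTermOn shiftSetFlat ε₀ (mirrorTable ε ε) S i k x| + |quadTermOn shiftSetFlat ε₀ (mirrorTable ε ε) (W z) i k x| :=
              abs_sub _ _
          _ ≤ clockW ε₀ k * Tα * |MS| ^ 2 + clockW ε₀ k * Tα * |MW| ^ 2 := add_le_add (hqS i k x hx) (hqW i k x hx)
          _ = clockW ε₀ k * Tα * (|MS| ^ 2 + |MW| ^ 2) := by ring) hs ht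
    rw [Real.norm_eq_abs, Real.norm_eq_abs] at h
    simpa only [Pi.sub_apply] using h
  have hcW0 : ∀ k, 0 ≤ clockW ε₀ k := fun k => (clockW_pos (by linarith) k).le
  have hcI : 0 ≤ clockW ε₀ (1 - (P.K : ℤ)) := hcW0 _
  have hcB1 : 0 ≤ clockW ε₀ (kB + 1) := hcW0 _
  set LD : ℝ := clockW ε₀ (1 - (P.K : ℤ)) * Tα * (|MS| ^ 2 + |MW| ^ 2) with hLD
  set La : ℝ := clockW ε₀ (kB + 1) * Tα * |MS| ^ 2 with hLa
  have hLD0 : 0 ≤ LD := by positivity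
  have hLa0 : 0 ≤ La := by positivity
  have hG2 : (0 : ℝ) < 2 * G := by positivity
  set L : ℝ := LD / RBAR + LD / BBAR + La / (2 * G) with hL
  have hL0 : 0 ≤ L := by positivity
  have hq1 : 0 ≤ LD / RBAR := by positivity
  have hq2 : 0 ≤ LD / BBAR := by positivity
  have hq3 : 0 ≤ La / (2 * G) := by positivity
  have hLR : LD ≤ L * RBAR := by
    have h1 : LD / RBAR ≤ L := by rw [hL]; linarith only [hq2, hq3]
    have e : LD / RBAR * RBAR = LD := by field_simp
    have := mul_le_mul_of_nonneg_right h1 hRB0.le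
    rwa [e] at this
  have hLB' : LD ≤ L * BBAR := by
    have h1 : LD / BBAR ≤ L := by rw [hL]; linarith only [hq1, hq3]
    have e : LD / BBAR * BBAR = LD := by field_simp
    have := mul_le_mul_of_nonneg_right h1 hBB0.le
    rwa [e] at this
  have hLa' : La ≤ L * (2 * G) := by
    have h1 : La / (2 * G) ≤ L := by rw [hL]; linarith only [hq1, hq2]
    have e : La / (2 * G) * (2 * G) = La := by field_simp
    have := mul_le_mul_of_nonneg_right h1 hG2.le
    rwa [e] at this
  -- the family: the two interface deviations at `1−K` and the two amplitudes at `k_B + 1`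
  let lev : Fin 2 → ℝ := fun i => if i = 0 then RBAR else BBAR
  have hlev0 : lev 0 = RBAR := by simp [lev]
  have hlev1 : lev 1 = BBAR := by simp [lev]
  have hlevpos : ∀ i, 0 < lev i := fun i => by
    fin_cases i
    · simp only [lev, Fin.zero_eta, Fin.isValue, if_true]; exact hRB0
    · simp only [lev, Fin.mk_one, Fin.isValue, one_ne_zero, if_false]; exact hBB0
  have hLlev : ∀ i, LD ≤ L * lev i := fun i => by
    fin_cases i
    · simp only [lev, Fin.zero_eta, Fin.isValue, if_true]; exact hLR
    · simp only [lev, Fin.mk_one, Fin.isValue, one_ne_zero, if_false]; exact hLB'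
  let u : Bool × Fin 2 → ℝ → ℝ := fun q t => if q.1 then |S q.2 (kB + 1) t| else |(S - W z) q.2 (1 - (P.K : ℤ)) t|
  let p : Bool × Fin 2 → ℝ := fun q => if q.1 then 2 * G else lev q.2
  have hp0 : ∀ q, 0 ≤ p q := by
    rintro ⟨b, i⟩; cases b
    · simp only [p]; exact (hlevpos i).le
    · simp only [p, if_true]; exact hG2.le
  -- initial values: section datum below the levels, initial tail below `G`
  have hPUMP0 : 0 ≤ PUMP := by rw [hPUMPdef]; positivity
  have hrsR : rs ≤ RBAR := by
    have h1 : 0 ≤ 1 * c₀ * ((ε * (M + I₁ * Real.sqrt (2 * VbarN)) + ε * M + ε * BBAR) * RBAR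
      + (2 + ε) * M * BBAR + BBAR ^ 2) := by positivity
    linarith only [hlevC, h1, hPUMP0]
  have hrsB : rs ≤ BBAR := by
    have h1 : 0 ≤ 1 * c₀ * ((M + M₂ + RBAR + RHO2) * BBAR + (1 + 2 * ε) * M * RBAR + ε * RBAR ^ 2
      + (M + 2 * ε * M₂) * RHO2 + ε * RHO2 ^ 2) := by positivity
    linarith only [hlevV, h1]
  have hrslev : ∀ i, rs ≤ lev i := fun i => by
    fin_cases i
    · simp only [lev, Fin.zero_eta, Fin.isValue, if_true]; exact hrsR
    · simp only [lev, Fin.mk_one, Fin.isValue, one_ne_zero, if_false]; exact hrsB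
  have h0a : ∀ i : Fin 2, |S₀ i (kB + 1)| ≤ G := by
    intro i
    have h := hinit {kB + 1} (by intro m hm; rw [Finset.mem_singleton] at hm; omega)
    rw [Finset.sum_singleton, Fin.sum_univ_two] at h
    have hsq : S₀ i (kB + 1) ^ 2 ≤ G ^ 2 := by
      fin_cases i
      · exact le_trans (le_add_of_nonneg_right (sq_nonneg (S₀ 1 (kB + 1)))) h
      · exact le_trans (le_add_of_nonneg_left (sq_nonneg (S₀ 0 (kB + 1)))) h
    exact abs_le.mpr (abs_le_of_sq_le_sq' hsq hG.le)
  -- (L) uniform Lipschitz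
  have hlip : ∀ q : Bool × Fin 2, ∀ s ∈ Icc 0 s₀, ∀ t ∈ Icc 0 s₀, |u q t - u q s| ≤ L * p q * |t - s| := by
    rintro ⟨b, i⟩ s hs t ht
    have hts : 0 ≤ |t - s| := abs_nonneg _
    cases b
    · simp only [u, p, Bool.false_eq_true, if_false]
      have htri : abs (|(S - W z) i (1 - (P.K : ℤ)) t| - |(S - W z) i (1 - (P.K : ℤ)) s|)
          ≤ |(S - W z) i (1 - (P.K : ℤ)) t - (S - W z) i (1 - (P.K : ℤ)) s| := abs_abs_sub_abs_le_abs_sub _ _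
      calc abs (|(S - W z) i (1 - (P.K : ℤ)) t| - |(S - W z) i (1 - (P.K : ℤ)) s|) ≤ LD * |t - s| :=
            htri.trans (hlipD i _ s hs t ht)
        _ ≤ L * lev i * |t - s| := mul_le_mul_of_nonneg_right (hLlev i) hts
    · simp only [u, p, if_true]
      have htri : abs (|S i (kB + 1) t| - |S i (kB + 1) s|) ≤ |S i (kB + 1) t - S i (kB + 1) s| :=
        abs_abs_sub_abs_le_abs_sub _ _
      calc abs (|S i (kB + 1) t| - |S i (kB + 1) s|) ≤ La * |t - s| := htri.trans (hlipS i _ s hs t ht)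
        _ ≤ L * (2 * G) * |t - s| := mul_le_mul_of_nonneg_right hLa' hts
  -- (0) initial values
  have h0 : ∀ q : Bool × Fin 2, u q 0 ≤ (fun _ : ℝ => (1 : ℝ)) 0 * p q := by
    rintro ⟨b, i⟩
    cases b
    · simp only [u, p, Bool.false_eq_true, if_false, one_mul]
      exact (hsec i).trans (hrslev i)
    · simp only [u, p, if_true, one_mul]
      rw [hS'.init_S]; linarith only [h0a i, hG]
  -- (I) the improvement step
  have himp : ∀ t ∈ Icc 0 s₀, (∀ q : Bool × Fin 2, ∀ s ∈ Icc 0 t, u q s ≤ 2 * (fun _ : ℝ => (1 : ℝ)) s * p q) →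
      ∀ q : Bool × Fin 2, u q t ≤ (fun _ : ℝ => (1 : ℝ)) t * p q := by
    intro t ht hpast
    have htc : t ≤ s₀ := ht.2
    -- the fat levels on `[0, t]`, hence the block deviation on `[0, t]`
    have hfat : ∀ s ∈ Icc 0 t, |(S - W z) 0 (1 - (P.K : ℤ)) s| ≤ 2 * RBAR ∧ |(S - W z) 1 (1 - (P.K : ℤ)) s| ≤ 2 * BBAR ∧
        ∀ i : Fin 2, |S i (kB + 1) s| ≤ 4 * G := by
      intro s hs
      refine ⟨?_, ?_, fun i => ?_⟩
      · have h := hpast (false, 0) s hs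
        simp only [u, p, Bool.false_eq_true, if_false] at h
        rw [hlev0] at h; linarith only [h]
      · have h := hpast (false, 1) s hs
        simp only [u, p, Bool.false_eq_true, if_false] at h
        rw [hlev1] at h; linarith only [h]
      · have h := hpast (true, i) s hs
        simp only [u, p, if_true] at h
        linarith only [h]
    have hIN := hblock t ht hfat
    rcases eq_or_lt_of_le ht.1 with h0t | htpos
    · -- `t = 0`: the initial values
      intro q; rw [← h0t]; exact h0 q
    rintro ⟨b, i⟩
    cases b
    · -- the near interface: the loop on `[0, t]` with the core input read off the block deviation
      simp only [u, p, Bool.false_eq_true, if_false, one_mul]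
      have hρ : ∀ s ∈ Icc 0 t, |(S - W z) 0 (2 - (P.K : ℤ)) s| ≤ RHO2 :=
        fun s hs => (hIN s hs 0 (2 - (P.K : ℤ)) le_rfl hKB).trans hρD
      have hl := hloop t htpos htc hρ t ⟨ht.1, le_rfl⟩
      fin_cases i
      · simp only [lev, Fin.zero_eta, Fin.isValue, if_true]; exact hl.1
      · simp only [lev, Fin.mk_one, Fin.isValue, one_ne_zero, if_false]; exact hl.2
    · -- the far interface: the per-flow cut step at horizon `t`
      simp only [u, p, if_true, one_mul]
      have hhull : ∀ s ∈ Icc 0 t, |S 1 kB s| ≤ Vtop := by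
        intro s hs
        have hd := hIN s hs 1 kB hKB le_rfl
        have hz' := hVt s ⟨hs.1, (hs.2.trans htc).trans hs₀c⟩
        have e : (S - W z) 1 kB s = S 1 kB s - W z 1 kB s := rfl
        rw [e] at hd
        have h3 := abs_sub_abs_le_abs_sub (S 1 kB s) (W z 1 kB s)
        linarith only [hd, hz', h3]
      exact aheadCutStep_flow hflow hε hε₀ ht.1 (htc.trans hs₀τ) (htc.trans hs₀c) hVtop hG.le hhull hinit hcloseA t
        ⟨ht.1, le_rfl⟩ i (kB + 1) (by omega)
  -- THE BOOTSTRAP, and reading off the conclusion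
  have key := GappedFrontRobust.bootstrap_family (u := u) (p := p) (ψ := fun _ : ℝ => (1 : ℝ)) (τ := s₀) (L := L)
    hp0 hL0 continuousOn_const (fun _ _ => one_pos) hlip h0 himp
  have hthin : ∀ s ∈ Icc 0 s₀, (|(S - W z) 0 (1 - (P.K : ℤ)) s| ≤ RBAR ∧ |(S - W z) 1 (1 - (P.K : ℤ)) s| ≤ BBAR) ∧
      ∀ i : Fin 2, |S i (kB + 1) s| ≤ 2 * G := by
    intro s hs
    refine ⟨⟨?_, ?_⟩, fun i => ?_⟩
    · have h := key (false, 0) s hs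
      simp only [u, p, Bool.false_eq_true, if_false, one_mul] at h
      rwa [hlev0] at h
    · have h := key (false, 1) s hs
      simp only [u, p, Bool.false_eq_true, if_false, one_mul] at h
      rwa [hlev1] at h
    · have h := key (true, i) s hs
      simp only [u, p, if_true, one_mul] at h
      exact h
  have hINall := hblock s₀ (right_mem_Icc.mpr hs₀.le) fun s hs =>
    ⟨(hthin s hs).1.1.trans (by linarith only [hRB0]), (hthin s hs).1.2.trans (by linarith only [hBB0]),
      fun i => ((hthin s hs).2 i).trans (by linarith only [hG])⟩
  have hhull : ∀ s ∈ Icc 0 s₀, |S 1 kB s| ≤ Vtop := by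
    intro s hs
    have hd := hINall s hs 1 kB hKB le_rfl
    have e : (S - W z) 1 kB s = S 1 kB s - W z 1 kB s := rfl
    rw [e] at hd
    have h3 := abs_sub_abs_le_abs_sub (S 1 kB s) (W z 1 kB s)
    linarith only [hVt s ⟨hs.1, hs.2.trans hs₀c⟩, hd, h3]
  intro s hs
  exact ⟨hINall s hs, (hthin s hs).1,
    fun i m hm => aheadCutStep_flow hflow hε hε₀ hs₀.le hs₀τ hs₀c hVtop hG.le hhull hinit hcloseA s hs i m hm⟩

end Flow

end Summit.NavierStokesRegularity.NavierStokesRegularity.Theorems.HopTube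

end
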